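import Summits.NavierStokesRegularity.NavierStokesRegularity.Theses.AxisymmetricExtremality
import Summits.NavierStokesRegularity.NavierStokesRegularity.Theorems.AxisymmetricExtremalityAxisymmetricKatoGlobalStubSereginLogSwirlOriginCutoffDivCurl
import Literature.Analysis.FluidPDE.PressureSpaceTimeTools
import Literature.Analysis.FluidPDE.SereginSverakPressureDecayBalls
import Mathlib.Analysis.FunctionalSpaces.SobolevInequality
import HarnessLib

/-!
# Seregin 2022, §2 Step 4 (assembly, I): the poloidal part
# `∫_{𝒞(R)} |v̄|³ ≤ c R^{3/2}` from `sup_t ‖η³Γ‖₂ ≤ K` — crux stmt-NavierStokesRegularity-15453 (`AxisymmetricExtremality.AxisymmetricKatoGlobal`), line registered, support for stub `stub_sereginLogSwirlOrigin`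

Support file (`--supports stmt-NavierStokesRegularity-15453`; theorems only, everything proved)
toward the registered stub `stub_sereginLogSwirlOrigin` = the named fact
`Literature.Analysis.FluidPDE.seregin2022_logSwirl_regularAtOrigin` (G. Seregin, J. Math. Fluid
Mech. 24 (2022), Paper 27 = arXiv:2201.00153, §2).  Step 4 ("Final Conclusion", arXiv p. 7)
derives `C(R) = R⁻²∫_{Q(R)}|v|³ → 0` from the Step-3 bound
`sup_t ∫_𝒞 η⁶(|Γ|² + |Φ|²) + ∫_Q (η³|∇Φ|)² + (η³|∇Γ|)² ≤ K` (`Γ = ω_θ/r`, `Φ = ω_r/r`).  For the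
poloidal part `v̄ = v_r e_r + v₃ e₃` the printed route is "`ω_θ = rΓ` ⇒ `|η³ω_θ|_{2,Q} < ∞`", the
first elliptic bound `‖∇(η³v̄)‖_{2,𝒞} ≤ c‖ω_θη³‖_{2,𝒞} + c‖|∇η³||v̄|‖_{2,𝒞}` (landed:
`lintegral_frobeniusNormSq_fderiv_smul_poloidal_le`, sibling file `…CutoffDivCurl.lean`) and a
Sobolev embedding, giving (2.8) `R⁻²∫_{Q(R)}|v̄|³ ≤ cR^γ → 0`.  This file proves the slice form
with `γ = 3/2` through `L^∞_t Ḣ¹ ⊂ L^∞_t L⁶` (any positive rate feeds the landed endgame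
`isRegularAtOrigin_of_tendsto_cubicC`), with `ζ` for `η³`, the tree's smooth poloidal field
`b = u − (u_θ/r)J` (`angVelQuot`, `rotGen`) for `v̄`, `Γ = angVortQuot u`, `Φ = radVelQuot (curl u)`:

* `lintegral_enorm_rpow_six_le` — Gagliardo–Nirenberg–Sobolev `∫‖w‖⁶ ≤ C_S⁶(∫‖Dw‖²)³` for `C¹_c`
  maps `ℝ³ → F'` into a Hilbert space, lower-integral form of Mathlib's
  `eLpNorm_le_eLpNorm_fderiv_of_eq_inner` (constant `C_S`);
* `norm_le_norm_poloidal_add_abs_swirlVelocity`, `enorm_pow_three_le_poloidal_add_swirl` —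
  `|v| ≤ |v̄| + |v_θ|`, `|v|³ ≤ 4(|v̄|³ + |v_θ|³)`;
* `lintegral_enorm_fderiv_smul_poloidal_sq_le` — at a fixed time,
  **`∫ ‖D(ζb)‖² ≤ 2K + 12 C_ζ² A`** from `∫ ζ²(Γ² + Φ²) ≤ K` (the Step-3 `sup` term),
  `∫_𝒞 |u|² ≤ A` (energy class), `‖Dζ‖ ≤ C_ζ`, `tsupport ζ ⊆ 𝒞` (so `r ≤ 1` there, `ω_θ² = r²Γ² ≤ Γ²`);
* `lintegral_enorm_smul_poloidal_rpow_six_le` — hence `∫ ‖ζb‖⁶ ≤ C_S⁶ (2K + 12C_ζ²A)³`;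
* `setLIntegral_spaceCyl_enorm_poloidal_pow_three_le` (registered; hypothesis form `…_le'`) —
  on every `𝒞(R)` where `ζ = 1`,
  **`∫_{𝒞(R)} |b|³ ≤ |𝒞(R)|^{1/2} (C_S⁶(2K + 12C_ζ²A)³)^{1/2}`**, `|𝒞(R)| ≤ 8|B₁|R³`
  (`volume_spaceCyl_le_rpow`).

## References

* G. Seregin, J. Math. Fluid Mech. 24 (2022), Paper No. 27 = arXiv:2201.00153, §2 Step 4 (arXiv
  p. 7: (2.7), the first "classical bound", (2.8)). [`Seregin2022LocalAxisym`]
-/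

noncomputable section

open Set MeasureTheory Filter Topology Function Metric
open scoped ENNReal NNReal RealInnerProductSpace
open Literature.Analysis.FluidPDE

-- `<Problem> = <Summit>` duplicates a namespace component by design (lakefile sets the same option).
set_option linter.dupNamespace false

namespace Summit.NavierStokesRegularity.NavierStokesRegularity.Theorems.AxisymmetricKatoGlobal.EulerScaling

/-! ### Gagliardo–Nirenberg–Sobolev in lower-integral form -/

/-- **GNS, `Ḣ¹(ℝ³) ⊂ L⁶`, lower-integral form**: for a `C¹` compactly supported map `w : ℝ³ → F'`
into a real Hilbert space, `∫ ‖w‖⁶ ≤ C_S⁶ (∫ ‖Dw‖²)³` with `C_S` Mathlib's constant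
(`eLpNorm_le_eLpNorm_fderiv_of_eq_inner`, sixth power). [folklore] -/
theorem lintegral_enorm_rpow_six_le {F' : Type*} [NormedAddCommGroup F'] [InnerProductSpace ℝ F']
    {w : EuclideanSpace ℝ (Fin 3) → F'} (hw : ContDiff ℝ 1 w) (hc : HasCompactSupport w) :
    ∫⁻ x, ‖w x‖ₑ ^ (6 : ℝ) ≤
      (eLpNormLESNormFDerivOfEqInnerConst (volume : Measure (EuclideanSpace ℝ (Fin 3))) 2 : ℝ≥0∞)
          ^ (6 : ℝ) * (∫⁻ x, ‖fderiv ℝ w x‖ₑ ^ 2) ^ (3 : ℝ) := by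
  have e2n : ∀ x, ‖fderiv ℝ w x‖ₑ ^ 2 = ‖fderiv ℝ w x‖ₑ ^ (2 : ℝ) := fun x =>
    (ENNReal.rpow_ofNat _ 2).symm
  simp only [e2n]
  have h := eLpNorm_le_eLpNorm_fderiv_of_eq_inner (volume : Measure (EuclideanSpace ℝ (Fin 3)))
    hw hc (p := 2) (p' := 6) (by norm_num) (by rw [finrank_euclideanSpace_fin]; norm_num)
    (by rw [finrank_euclideanSpace_fin]; norm_num)
  rw [eLpNorm_eq_lintegral_rpow_enorm_toReal (by norm_num) (by norm_num),
    eLpNorm_eq_lintegral_rpow_enorm_toReal (by norm_num) (by norm_num)] at h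
  have e6 : ((6 : ℝ≥0) : ℝ≥0∞).toReal = 6 := by norm_num
  have e2 : ((2 : ℝ≥0) : ℝ≥0∞).toReal = 2 := by norm_num
  have e2' : ((2 : ℝ≥0) : ℝ) = 2 := by norm_num
  rw [e6, e2, e2'] at h
  have h6 := ENNReal.rpow_le_rpow h (by norm_num : (0 : ℝ) ≤ 6)
  rw [← ENNReal.rpow_mul, show (1 : ℝ) / 6 * 6 = 1 by norm_num, ENNReal.rpow_one,
    ENNReal.mul_rpow_of_nonneg _ _ (by norm_num : (0 : ℝ) ≤ 6), ← ENNReal.rpow_mul,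
    show (1 : ℝ) / 2 * 6 = 3 by norm_num] at h6
  exact h6

/-! ### The decomposition `v = v̄ + v_θ e_θ` pointwise -/

section Pointwise

variable {u : EuclideanSpace ℝ (Fin 3) → EuclideanSpace ℝ (Fin 3)}

/-- **`|v| ≤ |v̄| + |v_θ|`**: for an axisymmetric `u ∈ C²` and its smooth poloidal part
`b = u − (u_θ/r)J`, `‖u x‖ ≤ ‖b x‖ + |u_θ x|` everywhere (`‖(u_θ/r)J‖ = |u_θ|` off the axis,
`J = 0` on it). [folklore] -/
theorem norm_le_norm_poloidal_add_abs_swirlVelocity (hax : IsAxisymmetric u) (hu : ContDiff ℝ 2 u)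
    (x : EuclideanSpace ℝ (Fin 3)) :
    ‖u x‖ ≤ ‖u x - angVelQuot u x • rotGen x‖ + |swirlVelocity u x| := by
  have hJ : ‖rotGen x‖ = cylRadius x := by rw [norm_rotGen]; rfl
  have hsm : ‖angVelQuot u x • rotGen x‖ ≤ |swirlVelocity u x| := by
    rw [norm_smul, Real.norm_eq_abs, hJ]
    rcases eq_or_ne (cylRadius x) 0 with h0 | h0
    · rw [h0, mul_zero]; exact abs_nonneg _
    · have h1 : cylRadius x ^ 2 * angVelQuot u x = cylRadius x * swirlVelocity u x := by
        rw [hax.cylRadius_sq_mul_angVelQuot hu x, swirl_eq_cylRadius_mul_swirlVelocity u h0]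
      have h2 : cylRadius x * angVelQuot u x = swirlVelocity u x := by
        have h3 : cylRadius x * (cylRadius x * angVelQuot u x) = cylRadius x * swirlVelocity u x := by
          rw [← h1]; ring
        exact mul_left_cancel₀ h0 h3
      rw [← h2, abs_mul, abs_of_nonneg (cylRadius_nonneg x), mul_comm]
  calc ‖u x‖ = ‖(u x - angVelQuot u x • rotGen x) + angVelQuot u x • rotGen x‖ := by
        rw [sub_add_cancel]
    _ ≤ ‖u x - angVelQuot u x • rotGen x‖ + ‖angVelQuot u x • rotGen x‖ := norm_add_le _ _
    _ ≤ ‖u x - angVelQuot u x • rotGen x‖ + |swirlVelocity u x| := by linarith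

/-- **`|v|³ ≤ 4(|v̄|³ + |v_θ|³)`** in `ℝ≥0∞`, for an axisymmetric `u ∈ C²`. [folklore] -/
theorem enorm_pow_three_le_poloidal_add_swirl (hax : IsAxisymmetric u) (hu : ContDiff ℝ 2 u)
    (x : EuclideanSpace ℝ (Fin 3)) :
    ‖u x‖ₑ ^ (3 : ℕ) ≤ 4 * (‖u x - angVelQuot u x • rotGen x‖ₑ ^ (3 : ℕ) +
      ‖swirlVelocity u x‖ₑ ^ (3 : ℕ)) := by
  have h1 : ‖u x‖ₑ ≤ ‖u x - angVelQuot u x • rotGen x‖ₑ + ‖swirlVelocity u x‖ₑ := by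
    rw [← ofReal_norm, ← ofReal_norm, Real.enorm_eq_ofReal_abs,
      ← ENNReal.ofReal_add (norm_nonneg _) (abs_nonneg _)]
    exact ENNReal.ofReal_le_ofReal (norm_le_norm_poloidal_add_abs_swirlVelocity hax hu x)
  have h2 := ENNReal.rpow_add_le_mul_rpow_add_rpow (‖u x - angVelQuot u x • rotGen x‖ₑ)
    (‖swirlVelocity u x‖ₑ) (p := 3) (by norm_num)
  rw [show (3 : ℝ) - 1 = 2 by norm_num] at h2
  have h4 : (2 : ℝ≥0∞) ^ (2 : ℝ) = 4 := by
    rw [show (2 : ℝ) = ((2 : ℕ) : ℝ) by norm_num, ENNReal.rpow_natCast]; norm_num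
  rw [h4] at h2
  simp only [ENNReal.rpow_ofNat] at h2
  exact (pow_le_pow_left' h1 3).trans h2

end Pointwise

/-! ### The first elliptic bound fed by the Step-3 `sup` term -/

section Slice

variable {u : EuclideanSpace ℝ (Fin 3) → EuclideanSpace ℝ (Fin 3)} {ζ : EuclideanSpace ℝ (Fin 3) → ℝ}
  {U : Set (EuclideanSpace ℝ (Fin 3))} {K A : ℝ≥0} {Cζ : ℝ}

/-- A cut-off supported in the unit cylinder `𝒞` has compact support. [folklore] -/
theorem hasCompactSupport_of_tsupport_subset_spaceCyl
    (hζ1 : tsupport ζ ⊆ SereginSverak2009.spaceCyl 0 1) : HasCompactSupport ζ := by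
  refine (ProperSpace.isCompact_closedBall (0 : EuclideanSpace ℝ (Fin 3)) (Real.sqrt 2 * 1)).of_isClosed_subset
    (isClosed_tsupport ζ) (hζ1.trans ((spaceCyl_subset_ball 0 zero_le_one).trans ball_subset_closedBall))

/-- **Lower integrals of functions vanishing off a set**: if `f = 0` off `S` and `f ≤ g` on `S`
(`S` measurable), then `∫ f ≤ ∫_S g`. [folklore] -/
theorem lintegral_le_setLIntegral_of_forall_notMem {α : Type*} [MeasurableSpace α] {μ : Measure α}
    {S : Set α} (hS : MeasurableSet S) {f g : α → ℝ≥0∞} (h0 : ∀ x ∉ S, f x = 0)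
    (hle : ∀ x ∈ S, f x ≤ g x) : ∫⁻ x, f x ∂μ ≤ ∫⁻ x in S, g x ∂μ := by
  have hf : f = S.indicator f := by
    funext x
    by_cases hx : x ∈ S
    · rw [indicator_of_mem hx]
    · rw [indicator_of_notMem hx, h0 x hx]
  rw [hf, lintegral_indicator hS]
  exact setLIntegral_mono' hS hle

/-- **`∫ ‖D(ζb)‖² ≤ 2K + 12 C_ζ² A` at a fixed time** (Seregin: "Since `ω_θ = rΓ`, one can state
that `|η³ω_θ|_{2,Q} < ∞` as well", then the first elliptic bound and "our previous arguments … in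
the support of `∇η`"). Inputs: `u ∈ C⁴(ℝ³)` axisymmetric and divergence free on an open
`U ⊇ tsupport ζ`; `ζ ∈ C²` with `tsupport ζ ⊆ 𝒞 = spaceCyl 0 1` and `‖Dζ‖ ≤ C_ζ`; the Step-3
`sup` term for `Γ` in the form (2.7), `‖ζΓ‖²₂ ≤ K`; the energy class `∫_𝒞 |u|² ≤ A`. (`r ≤ 1` on `𝒞`
turns `ζ²r²Γ²` into `≤ (ζΓ)²`; `|b| ≤ 2|u|`.) [cite: Seregin2022LocalAxisym, §2 Step 4 (arXiv:2201.00153 p. 7), (2.7) and the first elliptic bound] -/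
theorem lintegral_enorm_fderiv_smul_poloidal_sq_le (hax : IsAxisymmetric u) (hu : ContDiff ℝ 4 u)
    (hζ : ContDiff ℝ 2 ζ) (hU : IsOpen U) (hζU : tsupport ζ ⊆ U)
    (hζ1 : tsupport ζ ⊆ SereginSverak2009.spaceCyl 0 1)
    (hdiv : ∀ y ∈ U, VectorCalculus.divergence u y = 0) (hCζ : ∀ x, ‖fderiv ℝ ζ x‖ ≤ Cζ)
    (hΓ : ∫⁻ x, ‖ζ x * angVortQuot u x‖ₑ ^ 2 ≤ K)
    (hA : ∫⁻ x in SereginSverak2009.spaceCyl 0 1, ‖u x‖ₑ ^ 2 ≤ A) :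
    ∫⁻ x, ‖fderiv ℝ (fun y => ζ y • (u y - angVelQuot u y • rotGen y)) x‖ₑ ^ 2 ≤
      2 * K + 12 * ENNReal.ofReal (Cζ ^ 2) * A := by
  have hζc : HasCompactSupport ζ := hasCompactSupport_of_tsupport_subset_spaceCyl hζ1
  have hCζ0 : 0 ≤ Cζ := (norm_nonneg _).trans (hCζ 0)
  have key := lintegral_frobeniusNormSq_fderiv_smul_poloidal_le hax hu hζ hζc hU hζU hdiv
  -- first term: `ζ² r² Γ² ≤ (ζΓ)²` on `𝒞`
  have h1 : ∫⁻ x, ENNReal.ofReal (ζ x ^ 2 * ((x 0 ^ 2 + x 1 ^ 2) * angVortQuot u x ^ 2)) ≤ K := by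
    refine (lintegral_mono fun x => ?_).trans hΓ
    rw [Real.enorm_eq_ofReal_abs, ← ENNReal.ofReal_pow (abs_nonneg _), sq_abs]
    refine ENNReal.ofReal_le_ofReal ?_
    by_cases hx : x ∈ tsupport ζ
    · have hr : cylRadius x < 1 := by
        have := hζ1 hx
        rw [SereginSverak2009.mem_spaceCyl, sub_zero] at this
        exact this.1
      have hr2 : x 0 ^ 2 + x 1 ^ 2 ≤ 1 := by
        rw [← cylRadius_sq]; nlinarith [cylRadius_nonneg x]
      rw [mul_pow]
      refine mul_le_mul_of_nonneg_left ?_ (sq_nonneg _)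
      nlinarith [sq_nonneg (angVortQuot u x), add_nonneg (sq_nonneg (x 0)) (sq_nonneg (x 1))]
    · rw [image_eq_zero_of_notMem_tsupport hx]; simp
  -- second term: `‖Dζ‖² |b|² ≤ 4 C_ζ² |u|²` on `𝒞`, zero off `tsupport ζ`
  have h2 : ∫⁻ x, ENNReal.ofReal (‖fderiv ℝ ζ x‖ ^ 2 * ‖u x - angVelQuot u x • rotGen x‖ ^ 2) ≤
      4 * ENNReal.ofReal (Cζ ^ 2) * A := by
    have hb := Wei2016.norm_sub_angVelQuot_smul_rotGen_le hax (hu.of_le (by norm_num))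
    calc ∫⁻ x, ENNReal.ofReal (‖fderiv ℝ ζ x‖ ^ 2 * ‖u x - angVelQuot u x • rotGen x‖ ^ 2)
        ≤ ∫⁻ x in SereginSverak2009.spaceCyl 0 1, 4 * ENNReal.ofReal (Cζ ^ 2) * ‖u x‖ₑ ^ 2 := by
          refine lintegral_le_setLIntegral_of_forall_notMem
            (SereginSverak2009.isOpen_spaceCyl 0 1).measurableSet (fun x hx => ?_) (fun x _ => ?_)
          · have hx' : x ∉ tsupport ζ := fun h => hx (hζ1 h)
            rw [fderiv_of_notMem_tsupport ℝ hx', norm_zero]; simp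
          · have e1 : (4 : ℝ≥0∞) * ENNReal.ofReal (Cζ ^ 2) * ‖u x‖ₑ ^ 2 =
                ENNReal.ofReal (4 * Cζ ^ 2 * ‖u x‖ ^ 2) := by
              rw [← ofReal_norm, ← ENNReal.ofReal_pow (norm_nonneg _), ← ENNReal.ofReal_ofNat,
                ← ENNReal.ofReal_mul (by norm_num), ← ENNReal.ofReal_mul (by positivity)]
            rw [e1]
            refine ENNReal.ofReal_le_ofReal ?_
            have h3 : ‖fderiv ℝ ζ x‖ ^ 2 ≤ Cζ ^ 2 := pow_le_pow_left₀ (norm_nonneg _) (hCζ x) 2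
            have h4 : ‖u x - angVelQuot u x • rotGen x‖ ^ 2 ≤ (2 * ‖u x‖) ^ 2 :=
              pow_le_pow_left₀ (norm_nonneg _) (hb x) 2
            calc ‖fderiv ℝ ζ x‖ ^ 2 * ‖u x - angVelQuot u x • rotGen x‖ ^ 2
                ≤ Cζ ^ 2 * (2 * ‖u x‖) ^ 2 :=
                  mul_le_mul h3 h4 (sq_nonneg _) (sq_nonneg _)
              _ = 4 * Cζ ^ 2 * ‖u x‖ ^ 2 := by ring
      _ = 4 * ENNReal.ofReal (Cζ ^ 2) * ∫⁻ x in SereginSverak2009.spaceCyl 0 1, ‖u x‖ₑ ^ 2 := by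
          rw [lintegral_const_mul' _ _ (ENNReal.mul_ne_top (by norm_num) ENNReal.ofReal_ne_top)]
      _ ≤ 4 * ENNReal.ofReal (Cζ ^ 2) * A := by gcongr
  calc ∫⁻ x, ‖fderiv ℝ (fun y => ζ y • (u y - angVelQuot u y • rotGen y)) x‖ₑ ^ 2
      ≤ ∫⁻ x, ENNReal.ofReal (frobeniusNormSq
          (fderiv ℝ (fun y => ζ y • (u y - angVelQuot u y • rotGen y)) x)) :=
        lintegral_mono fun x => by
          -- `‖L‖ₑ² ≤ |L|²_F` (operator norm against Frobenius norm)
          rw [← ofReal_norm, ← ENNReal.ofReal_pow (norm_nonneg _)]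
          exact ENNReal.ofReal_le_ofReal (sq_opNorm_le_frobeniusNormSq _)
    _ ≤ 2 * K + 3 * (4 * ENNReal.ofReal (Cζ ^ 2) * A) := key.trans (add_le_add (by gcongr) (by gcongr))
    _ = 2 * K + 12 * ENNReal.ofReal (Cζ ^ 2) * A := by ring

/-- **`∫ ‖ζ b‖⁶ ≤ C_S⁶ (2K + 12C_ζ²A)³`** at a fixed time (GNS applied to the `C²_c` field `ζb` and
the previous bound): Seregin's "`|∇(η³v̄)|_{2,Q}` is bounded, that in turn yields boundedness
of" a Lebesgue norm of `η³v̄`, here `L^∞_t L⁶_x`. [cite: Seregin2022LocalAxisym, §2 Step 4 (arXiv:2201.00153 p. 7), before (2.8)] -/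
theorem lintegral_enorm_smul_poloidal_rpow_six_le (hax : IsAxisymmetric u) (hu : ContDiff ℝ 4 u)
    (hζ : ContDiff ℝ 2 ζ) (hU : IsOpen U) (hζU : tsupport ζ ⊆ U)
    (hζ1 : tsupport ζ ⊆ SereginSverak2009.spaceCyl 0 1)
    (hdiv : ∀ y ∈ U, VectorCalculus.divergence u y = 0) (hCζ : ∀ x, ‖fderiv ℝ ζ x‖ ≤ Cζ)
    (hΓ : ∫⁻ x, ‖ζ x * angVortQuot u x‖ₑ ^ 2 ≤ K)
    (hA : ∫⁻ x in SereginSverak2009.spaceCyl 0 1, ‖u x‖ₑ ^ 2 ≤ A) :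
    ∫⁻ x, ‖ζ x • (u x - angVelQuot u x • rotGen x)‖ₑ ^ (6 : ℝ) ≤
      (eLpNormLESNormFDerivOfEqInnerConst (volume : Measure (EuclideanSpace ℝ (Fin 3))) 2 : ℝ≥0∞)
          ^ (6 : ℝ) * (2 * K + 12 * ENNReal.ofReal (Cζ ^ 2) * A) ^ (3 : ℝ) := by
  have hζc : HasCompactSupport ζ := hasCompactSupport_of_tsupport_subset_spaceCyl hζ1
  have hJ : ContDiff ℝ 2 (rotGen : EuclideanSpace ℝ (Fin 3) → EuclideanSpace ℝ (Fin 3)) := by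
    rw [show (rotGen : EuclideanSpace ℝ (Fin 3) → EuclideanSpace ℝ (Fin 3)) = ⇑rotGenL from
      funext fun v => rfl]
    exact rotGenL.contDiff
  have hb : ContDiff ℝ 2 fun y => u y - angVelQuot u y • rotGen y :=
    (hu.of_le (by norm_num)).sub ((contDiff_angVelQuot (n := 2) hu).smul hJ)
  have hW : ContDiff ℝ 1 fun y => ζ y • (u y - angVelQuot u y • rotGen y) :=
    (hζ.of_le (by norm_num)).smul (hb.of_le (by norm_num))
  have hWc : HasCompactSupport fun y => ζ y • (u y - angVelQuot u y • rotGen y) := hζc.smul_right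
  refine (lintegral_enorm_rpow_six_le hW hWc).trans ?_
  gcongr
  exact lintegral_enorm_fderiv_smul_poloidal_sq_le hax hu hζ hU hζU hζ1 hdiv hCζ hΓ hA

/-- `|𝒞(R)| ≤ 8|B₁| R³` with `R³` as a real power of `ENNReal.ofReal R`. [folklore] -/
theorem volume_spaceCyl_le_rpow {R : ℝ} (hR : 0 < R) :
    volume (SereginSverak2009.spaceCyl (0 : EuclideanSpace ℝ (Fin 3)) R) ≤
      8 * volume (ball (0 : EuclideanSpace ℝ (Fin 3)) 1) * ENNReal.ofReal R ^ (3 : ℝ) := by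
  refine (SereginSverak2009.volume_spaceCyl_le 0 hR).trans (le_of_eq ?_)
  rw [mul_pow, show (2 : ℝ) ^ 3 = 8 by norm_num, ENNReal.ofReal_mul (by norm_num),
    ENNReal.ofReal_ofNat, ENNReal.ofReal_pow hR.le,
    show (3 : ℝ) = ((3 : ℕ) : ℝ) by norm_num, ENNReal.rpow_natCast]
  ring

/-- **The poloidal slice bound** (Seregin's (2.8) at a fixed time, rate `R^{3/2}`): under the
hypotheses of `lintegral_enorm_smul_poloidal_rpow_six_le`, on every cylinder `𝒞(R)`, `R > 0`, on
which `ζ = 1`: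
`∫_{𝒞(R)} |b|³ ≤ (8|B₁|R³)^{1/2} · (C_S⁶ (2K + 12C_ζ²A)³)^{1/2}` (Cauchy–Schwarz on `𝒞(R)`).
[cite: Seregin2022LocalAxisym, §2 Step 4 (arXiv:2201.00153 p. 7), (2.8)] -/
theorem setLIntegral_spaceCyl_enorm_poloidal_pow_three_le' (hax : IsAxisymmetric u)
    (hu : ContDiff ℝ 4 u) (hζ : ContDiff ℝ 2 ζ) (hU : IsOpen U) (hζU : tsupport ζ ⊆ U)
    (hζ1 : tsupport ζ ⊆ SereginSverak2009.spaceCyl 0 1)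
    (hdiv : ∀ y ∈ U, VectorCalculus.divergence u y = 0) (hCζ : ∀ x, ‖fderiv ℝ ζ x‖ ≤ Cζ)
    (hΓ : ∫⁻ x, ‖ζ x * angVortQuot u x‖ₑ ^ 2 ≤ K)
    (hA : ∫⁻ x in SereginSverak2009.spaceCyl 0 1, ‖u x‖ₑ ^ 2 ≤ A)
    {R : ℝ} (hR : 0 < R) (hζR : ∀ x ∈ SereginSverak2009.spaceCyl 0 R, ζ x = 1) :
    ∫⁻ x in SereginSverak2009.spaceCyl 0 R, ‖u x - angVelQuot u x • rotGen x‖ₑ ^ (3 : ℕ) ≤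
      (8 * volume (ball (0 : EuclideanSpace ℝ (Fin 3)) 1) * ENNReal.ofReal R ^ (3 : ℝ)) ^ (1 / 2 : ℝ) *
        ((eLpNormLESNormFDerivOfEqInnerConst (volume : Measure (EuclideanSpace ℝ (Fin 3))) 2 : ℝ≥0∞)
          ^ (6 : ℝ) * (2 * K + 12 * ENNReal.ofReal (Cζ ^ 2) * A) ^ (3 : ℝ)) ^ (1 / 2 : ℝ) := by
  set b : EuclideanSpace ℝ (Fin 3) → EuclideanSpace ℝ (Fin 3) := fun x => u x - angVelQuot u x • rotGen x
    with hbdef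
  set μ : Measure (EuclideanSpace ℝ (Fin 3)) := volume.restrict (SereginSverak2009.spaceCyl 0 R) with hμ
  have hJ : ContDiff ℝ 2 (rotGen : EuclideanSpace ℝ (Fin 3) → EuclideanSpace ℝ (Fin 3)) := by
    rw [show (rotGen : EuclideanSpace ℝ (Fin 3) → EuclideanSpace ℝ (Fin 3)) = ⇑rotGenL from
      funext fun v => rfl]
    exact rotGenL.contDiff
  have hbc : Continuous b :=
    ((hu.of_le (by norm_num)).sub ((contDiff_angVelQuot (n := 2) hu).smul hJ)).continuous
  have hbm : AEMeasurable (fun x => ‖b x‖ₑ ^ (3 : ℝ)) μ :=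
    (hbc.measurable.enorm.pow_const _).aemeasurable
  -- Cauchy–Schwarz `∫ 1 · |b|³ ≤ (∫ 1)^{1/2} (∫ |b|⁶)^{1/2}` on `𝒞(R)`
  have hCS := ENNReal.lintegral_mul_le_Lp_mul_Lq μ Real.HolderConjugate.two_two
    (f := fun _ => (1 : ℝ≥0∞)) aemeasurable_const hbm
  simp only [Pi.mul_apply, one_mul, ENNReal.one_rpow, lintegral_const, one_div] at hCS
  have e3 : ∀ x, ‖b x‖ₑ ^ (3 : ℕ) = ‖b x‖ₑ ^ (3 : ℝ) := fun x => by
    rw [show (3 : ℝ) = ((3 : ℕ) : ℝ) by norm_num, ENNReal.rpow_natCast]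
  have e6 : ∀ x, (‖b x‖ₑ ^ (3 : ℝ)) ^ (2 : ℝ) = ‖b x‖ₑ ^ (6 : ℝ) := fun x => by
    rw [← ENNReal.rpow_mul]; norm_num
  have hI : ∫⁻ a, (‖b a‖ₑ ^ (3 : ℝ)) ^ (2 : ℝ) ∂μ = ∫⁻ a, ‖b a‖ₑ ^ (6 : ℝ) ∂μ := lintegral_congr e6
  rw [hI] at hCS
  show ∫⁻ x, ‖b x‖ₑ ^ (3 : ℕ) ∂μ ≤ _
  simp only [e3]
  refine hCS.trans ?_
  rw [one_div]
  gcongr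
  · -- `μ univ = |𝒞(R)| ≤ 8|B₁|R³`
    rw [hμ, Measure.restrict_apply_univ]
    exact volume_spaceCyl_le_rpow hR
  · -- `∫_{𝒞(R)} |b|⁶ = ∫_{𝒞(R)} |ζb|⁶ ≤ ∫ |ζb|⁶`
    calc ∫⁻ x, ‖b x‖ₑ ^ (6 : ℝ) ∂μ = ∫⁻ x in SereginSverak2009.spaceCyl 0 R, ‖ζ x • b x‖ₑ ^ (6 : ℝ) := by
          rw [hμ]
          refine setLIntegral_congr_fun (SereginSverak2009.isOpen_spaceCyl 0 R).measurableSet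
            fun x hx => ?_
          simp only [hζR x hx, one_smul]
      _ ≤ ∫⁻ x, ‖ζ x • b x‖ₑ ^ (6 : ℝ) := setLIntegral_le_lintegral _ _
      _ ≤ _ := lintegral_enorm_smul_poloidal_rpow_six_le hax hu hζ hU hζU hζ1 hdiv hCζ hΓ hA

end Slice

/-- **The poloidal slice bound of Seregin 2022, §2 Step 4** (registered form): for an axisymmetric
`u ∈ C⁴(ℝ³)`, divergence free on an open `U`, a `C²` cut-off `ζ` with `tsupport ζ ⊆ U ∩ 𝒞`,
`‖Dζ‖ ≤ C_ζ`, the (2.7) `sup` term `‖ζΓ‖₂² ≤ K` (`Γ = angVortQuot u = ω_θ/r`), the energy class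
`∫_𝒞 |u|² ≤ A`, and a cylinder `𝒞(R)`, `R > 0`, on which `ζ = 1`:
`∫_{𝒞(R)} |b|³ ≤ (8|B₁|R³)^{1/2} (C_S⁶(2K + 12C_ζ²A)³)^{1/2}` for the smooth poloidal part
`b = u − (u_θ/r)J` (`= v̄`), i.e. (2.8) at a fixed time with rate `R^{3/2}`.
[cite: Seregin2022LocalAxisym, §2 Step 4 (arXiv:2201.00153 p. 7), first elliptic bound and (2.8)] -/
theorem setLIntegral_spaceCyl_enorm_poloidal_pow_three_le : ∀ (u : EuclideanSpace ℝ (Fin 3) → EuclideanSpace ℝ (Fin 3)) (ζ : EuclideanSpace ℝ (Fin 3) → ℝ) (U : Set (EuclideanSpace ℝ (Fin 3))) (Cζ R : ℝ) (K A : ℝ≥0), IsAxisymmetric u → ContDiff ℝ 4 u → ContDiff ℝ 2 ζ → IsOpen U → tsupport ζ ⊆ U → tsupport ζ ⊆ SereginSverak2009.spaceCyl 0 1 → (∀ y ∈ U, VectorCalculus.divergence u y = 0) → (∀ x, ‖fderiv ℝ ζ x‖ ≤ Cζ) → (∫⁻ x, ‖ζ x * angVortQuot u x‖ₑ ^ 2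 ≤ K) → (∫⁻ x in SereginSverak2009.spaceCyl 0 1, ‖u x‖ₑ ^ 2 ≤ A) → 0 < R → (∀ x ∈ SereginSverak2009.spaceCyl 0 R, ζ x = 1) → ∫⁻ x in SereginSverak2009.spaceCyl 0 R, ‖u x - angVelQuot u x • rotGen x‖ₑ ^ (3 : ℕ) ≤ (8 * volume (ball (0 : EuclideanSpace ℝ (Fin 3)) 1) * ENNReal.ofReal R ^ (3 : ℝ)) ^ (1 / 2 : ℝ) * ((eLpNormLESNormFDerivOfEqInnerConst (volume : Measure (EuclideanSpace ℝ (Fin 3))) 2 : ℝ≥0∞) ^ (6 : ℝ) * (2 * K + 12 * ENNReal.ofReal (Cζ ^ 2) * A) ^ (3 : ℝ)) ^ (1 / 2 : ℝ) :=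
  fun _ _ _ _ _ _ _ hax hu hζ hU hζU hζ1 hdiv hCζ hΓ hA hR hζR =>
    setLIntegral_spaceCyl_enorm_poloidal_pow_three_le' hax hu hζ hU hζU hζ1 hdiv hCζ hΓ hA hR hζR

end Summit.NavierStokesRegularity.NavierStokesRegularity.Theorems.AxisymmetricKatoGlobal.EulerScaling

end
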